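import Mathlib
import HarnessLib
import Summits.HubbardSuperconductivity.HubbardSuperconductivity.Theorems.KLProgrammeKLRegimeEnginePairTransferPPRateLoc

/-!
# Route `KLProgramme` — ENGINE item stmt-HubbardSuperconductivity-20437 `KLRegimeEngineV17F2`: the pp slice-bubble RATE kernel with a GENERIC SOFT LINE `D` at a deeper
# scale `m ≥ n` (the `D`-rung of class #5's relative family, `D = s_{n+1,j} − s_{n+1,j′}` soft at `j′`) — PRODUCER-SIDE BRICK 4a: pointwise size and SUPPORT
# (cell gate-hubbard-kl, seat hubbard-kl-k3c2-p2 g29, technique «thermal-bar induction n ≤ nScales β + 1 with EngineBoundsAtV4S sums»)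

WHY.  Bricks 1–3 (…PPRateSupport / …PPRateWindow / …PPRateLoc) treat θ's rate kernel `Br j Qm t` whose soft line is the running member symbol `Φ_j(t)` (soft at scale
`n`); they serve the OUT-of-class row `hLr` and, verbatim, the IN-class rows `RL₁ RL₂` of k3c1-p1's `pairTransferStep7_of_analytic_masses` (frame `K_{n+1}`) — the (c)
closer's supply of KLTC-INDEX v10 §D «`RL₁ RL₂ Rl₁ Rl₂` — localisation».  The in-class row `Rl₁` carries instead the `D`-RUNG rate
`BrD(z) = −(βL²)⁻¹ĝ(z.2,z.1)ĝ(z.2ʳ,Qm−z.1)·(Λₙ₊₁−Λₙ)(−Ẇ_t(z.2,z.1)·D(z.2ʳ,Qm−z.1) − D(z.2,z.1)·Ẇ_t(z.2ʳ,Qm−z.1))` with `D = s_{n+1,j} − s_{n+1,j′}`, soft at the DEEPER scale `j′`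
(`softSymbolCompl_sub_compl_mem`).  This file and its sequel (…PPRateDLineMass) redo bricks 1–3 for an ARBITRARY weight `D` with `0 ≤ D ≤ 1 − w^K_{Λ_m}`, `n ≤ m`
(kernel bound by `hBr : BrD = fun z => …`; instantiate with `rfl`): here `klpd_norm_rate_le` (pointwise), `klpd_rate_eq_zero_of_sq_lt` / `klpd_sq_le_of_rate_ne_zero` (band
`ω_{z.2}² ≤ Λ(t)² ≤ (4Λₙ₊₁)²`), `klpd_rate_eq_zero_of_not_mem_ball` / `klpd_mem_ball_of_rate_ne_zero` (ball, `|K(p)| ≤ A`, `Λₙ + A ≤ e₀`, using `w^K_{Λ_m} = 1` above scale `n ≤ m`).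
Real analysis over landed rows; nothing asserts (c), (X).3, K3 or superconductivity.  0 kit · 0 lit.
-/

noncomputable section

namespace Summit.HubbardSuperconductivity.HubbardSuperconductivity.Theorems.KLRegimeSplit

set_option linter.dupNamespace false -- summit = problem name (single-conjunct summit), D-0017

open Real Set Finset Complex Literature.MathematicalPhysics.QuantumLattice
open Literature.Probability.LatticeModels hiding torusSupNorm
open Summit.HubbardSuperconductivity.HubbardSuperconductivity.Theorems.KLProgrammeLegKernels
open Summit.HubbardSuperconductivity.HubbardSuperconductivity.Theorems.KLRegimeWick
open Summit.HubbardSuperconductivity.HubbardSuperconductivity.Theorems.TwoPointAssembly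
open Summit.HubbardSuperconductivity.HubbardSuperconductivity.Theorems.DispersionFlow
open Summit.HubbardSuperconductivity.HubbardSuperconductivity.Theorems.EngineV8

variable {L M : ℕ} [NeZero L] (β μ : ℝ) (K : TrigPolyC4v) {R : RenConsts} {U : ℝ} {N : ℕ}

/-! ## §1 Pointwise size and support -/

section Pointwise

omit [NeZero L] in
/-- `|−a·b − c·d| ≤ |a|·|b| + |c|·|d|`. -/
private theorem abs_neg_mul_sub_mul_le' (a b c d : ℝ) : |-a * b - c * d| ≤ |a| * |b| + |c| * |d| := by
  rw [show -a * b - c * d = -(a * b + c * d) by ring, abs_neg]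
  exact (abs_add_le _ _).trans (by rw [abs_mul, abs_mul])

/-- **The `D`-rung rate kernel, pointwise**: `‖BrD z‖ ≤ (βL²)⁻¹·((Λₙ − Λₙ₊₁)·(128/3)/Λ(t)²)·(|D(z′)|‖ĝ_K z′‖ + |D(z)|‖ĝ_K z‖)`, `z′ = (z.2ʳ, Qm − z.1)` (`0 < β`, `t ∈ [0,1]`). -/
theorem klpd_norm_rate_le (hβ : 0 < β) (n : ℕ) {t : ℝ} (ht : t ∈ Icc (0 : ℝ) 1) (D : FreqMomentum L M → ℝ)
    (Wd : ℝ → FreqMomentum L M → ℝ)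
    (hWd : Wd = fun t k => deriv (fun Λ' : ℝ => hubbardCutoffWeightCT L M β μ K Λ' k) (klScale klE0 n + t * (klScale klE0 (n + 1) - klScale klE0 n)))
    (Qm : TorusSite 2 L) (BrD : TorusSite 2 L × MatsubaraIdx M → ℂ)
    (hBr : BrD = fun z => -(((((β * (L : ℝ) ^ 2 : ℝ) : ℂ)))⁻¹ * propCT L M β μ K (z.2, z.1) * propCT L M β μ K (z.2.rev, Qm - z.1)) *
      ((((klScale klE0 (n + 1) - klScale klE0 n) * (-Wd t (z.2, z.1) * D (z.2.rev, Qm - z.1) - D (z.2, z.1) * Wd t (z.2.rev, Qm - z.1))) : ℝ) : ℂ))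
    (z : TorusSite 2 L × MatsubaraIdx M) :
    ‖BrD z‖ ≤ (β * (L : ℝ) ^ 2)⁻¹ * ((klScale klE0 n - klScale klE0 (n + 1)) * (128 / 3 / (klScale klE0 n + t * (klScale klE0 (n + 1) - klScale klE0 n)) ^ 2)) *
      (|D (z.2.rev, Qm - z.1)| * ‖propCT L M β μ K (z.2.rev, Qm - z.1)‖ + |D (z.2, z.1)| * ‖propCT L M β μ K (z.2, z.1)‖) := by
  have hL : (0 : ℝ) < L := Nat.cast_pos.2 (Nat.pos_of_ne_zero (NeZero.ne L))
  have hβL2 : 0 < β * (L : ℝ) ^ 2 := by positivity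
  have h10 := (klmf_klScale_succ_pos_le n).2
  have h1 := (klmf_klScale_succ_pos_le n).1
  set Λt : ℝ := klScale klE0 n + t * (klScale klE0 (n + 1) - klScale klE0 n) with hΛt_def
  have hmem : Λt ∈ Icc (klScale klE0 (n + 1)) (klScale klE0 n) := klws_affine_mem_Icc h10 ht
  have hΛt : 0 < Λt := h1.trans_le hmem.1
  set g₁ : ℂ := propCT L M β μ K (z.2, z.1) with hg₁
  set g₂ : ℂ := propCT L M β μ K (z.2.rev, Qm - z.1) with hg₂
  have hD₁ : |Wd t (z.2, z.1)| * ‖g₁‖ ≤ 128 / 3 / Λt ^ 2 := by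
    rw [hWd]; exact abs_derivWeight_mul_norm_propCT_le β μ K hΛt (z.2, z.1)
  have hD₂ : |Wd t (z.2.rev, Qm - z.1)| * ‖g₂‖ ≤ 128 / 3 / Λt ^ 2 := by
    rw [hWd]; exact abs_derivWeight_mul_norm_propCT_le β μ K hΛt (z.2.rev, Qm - z.1)
  have hnorm : ‖BrD z‖ = (β * (L : ℝ) ^ 2)⁻¹ * (klScale klE0 n - klScale klE0 (n + 1)) *
      (‖g₁‖ * ‖g₂‖ * |-Wd t (z.2, z.1) * D (z.2.rev, Qm - z.1) - D (z.2, z.1) * Wd t (z.2.rev, Qm - z.1)|) := by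
    simp only [hBr]
    rw [norm_mul, norm_neg, norm_mul, norm_mul, norm_inv, Complex.norm_real, Complex.norm_real, Real.norm_eq_abs, Real.norm_eq_abs,
      abs_of_pos hβL2, abs_mul, abs_of_nonpos (by linarith [hmem.1, hmem.2]), neg_sub]
    ring
  have key : ‖g₁‖ * ‖g₂‖ * |-Wd t (z.2, z.1) * D (z.2.rev, Qm - z.1) - D (z.2, z.1) * Wd t (z.2.rev, Qm - z.1)| ≤
      128 / 3 / Λt ^ 2 * (|D (z.2.rev, Qm - z.1)| * ‖g₂‖ + |D (z.2, z.1)| * ‖g₁‖) := by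
    calc ‖g₁‖ * ‖g₂‖ * |-Wd t (z.2, z.1) * D (z.2.rev, Qm - z.1) - D (z.2, z.1) * Wd t (z.2.rev, Qm - z.1)|
        ≤ ‖g₁‖ * ‖g₂‖ * (|Wd t (z.2, z.1)| * |D (z.2.rev, Qm - z.1)| + |D (z.2, z.1)| * |Wd t (z.2.rev, Qm - z.1)|) :=
          mul_le_mul_of_nonneg_left (abs_neg_mul_sub_mul_le' _ _ _ _) (by positivity)
      _ = (|Wd t (z.2, z.1)| * ‖g₁‖) * (|D (z.2.rev, Qm - z.1)| * ‖g₂‖) + (|Wd t (z.2.rev, Qm - z.1)| * ‖g₂‖) * (|D (z.2, z.1)| * ‖g₁‖) := by ring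
      _ ≤ 128 / 3 / Λt ^ 2 * (|D (z.2.rev, Qm - z.1)| * ‖g₂‖) + 128 / 3 / Λt ^ 2 * (|D (z.2, z.1)| * ‖g₁‖) :=
          add_le_add (mul_le_mul_of_nonneg_right hD₁ (by positivity)) (mul_le_mul_of_nonneg_right hD₂ (by positivity))
      _ = 128 / 3 / Λt ^ 2 * (|D (z.2.rev, Qm - z.1)| * ‖g₂‖ + |D (z.2, z.1)| * ‖g₁‖) := by ring
  have hdiff : 0 ≤ klScale klE0 n - klScale klE0 (n + 1) := by linarith
  rw [hnorm]
  calc (β * (L : ℝ) ^ 2)⁻¹ * (klScale klE0 n - klScale klE0 (n + 1)) *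
        (‖g₁‖ * ‖g₂‖ * |-Wd t (z.2, z.1) * D (z.2.rev, Qm - z.1) - D (z.2, z.1) * Wd t (z.2.rev, Qm - z.1)|)
      ≤ (β * (L : ℝ) ^ 2)⁻¹ * (klScale klE0 n - klScale klE0 (n + 1)) *
          (128 / 3 / Λt ^ 2 * (|D (z.2.rev, Qm - z.1)| * ‖g₂‖ + |D (z.2, z.1)| * ‖g₁‖)) :=
        mul_le_mul_of_nonneg_left key (by positivity)
    _ = _ := by ring

omit [NeZero L] in
/-- **Frequency support**: `Λ(t)² < ω_{z.2}² ⇒ BrD z = 0` (both terms carry a `Ẇ_{Λ(t)}` factor at `±ω_{z.2}`). -/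
theorem klpd_rate_eq_zero_of_sq_lt (n : ℕ) {t : ℝ} (ht : t ∈ Icc (0 : ℝ) 1) (D : FreqMomentum L M → ℝ)
    (Wd : ℝ → FreqMomentum L M → ℝ)
    (hWd : Wd = fun t k => deriv (fun Λ' : ℝ => hubbardCutoffWeightCT L M β μ K Λ' k) (klScale klE0 n + t * (klScale klE0 (n + 1) - klScale klE0 n)))
    (Qm : TorusSite 2 L) (BrD : TorusSite 2 L × MatsubaraIdx M → ℂ)
    (hBr : BrD = fun z => -(((((β * (L : ℝ) ^ 2 : ℝ) : ℂ)))⁻¹ * propCT L M β μ K (z.2, z.1) * propCT L M β μ K (z.2.rev, Qm - z.1)) *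
      ((((klScale klE0 (n + 1) - klScale klE0 n) * (-Wd t (z.2, z.1) * D (z.2.rev, Qm - z.1) - D (z.2, z.1) * Wd t (z.2.rev, Qm - z.1))) : ℝ) : ℂ))
    {z : TorusSite 2 L × MatsubaraIdx M} (hz : (klScale klE0 n + t * (klScale klE0 (n + 1) - klScale klE0 n)) ^ 2 < matsubaraFreq β M z.2 ^ 2) :
    BrD z = 0 := by
  have h10 := (klmf_klScale_succ_pos_le n).2
  have h1 := (klmf_klScale_succ_pos_le n).1
  set Λt : ℝ := klScale klE0 n + t * (klScale klE0 (n + 1) - klScale klE0 n) with hΛt_def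
  have hmem : Λt ∈ Icc (klScale klE0 (n + 1)) (klScale klE0 n) := klws_affine_mem_Icc h10 ht
  have hΛt : 0 < Λt := h1.trans_le hmem.1
  have hW₁ : Wd t (z.2, z.1) = 0 := by
    rw [hWd]
    exact klws_deriv_cutoffWeight_scale_eq_zero L M β μ K hΛt.ne' (z.2, z.1) (Or.inr (by nlinarith [sq_nonneg (nambuXiCT L μ K z.1)]))
  have hW₂ : Wd t (z.2.rev, Qm - z.1) = 0 := by
    rw [hWd]
    refine klws_deriv_cutoffWeight_scale_eq_zero L M β μ K hΛt.ne' (z.2.rev, Qm - z.1) (Or.inr ?_)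
    have hrev : matsubaraFreq β M (Fin.rev z.2) ^ 2 = matsubaraFreq β M z.2 ^ 2 := by rw [matsubaraFreq_rev, neg_sq]
    simp only
    rw [hrev]
    nlinarith [sq_nonneg (nambuXiCT L μ K (Qm - z.1))]
  simp only [hBr, hW₁, hW₂, neg_zero, zero_mul, mul_zero, sub_zero, Complex.ofReal_zero]

omit [NeZero L] in
/-- … contrapositive: `BrD z ≠ 0 ⇒ ω_{z.2}² ≤ (4Λₙ₊₁)²`. -/
theorem klpd_sq_le_of_rate_ne_zero (n : ℕ) {t : ℝ} (ht : t ∈ Icc (0 : ℝ) 1) (D : FreqMomentum L M → ℝ)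
    (Wd : ℝ → FreqMomentum L M → ℝ)
    (hWd : Wd = fun t k => deriv (fun Λ' : ℝ => hubbardCutoffWeightCT L M β μ K Λ' k) (klScale klE0 n + t * (klScale klE0 (n + 1) - klScale klE0 n)))
    (Qm : TorusSite 2 L) (BrD : TorusSite 2 L × MatsubaraIdx M → ℂ)
    (hBr : BrD = fun z => -(((((β * (L : ℝ) ^ 2 : ℝ) : ℂ)))⁻¹ * propCT L M β μ K (z.2, z.1) * propCT L M β μ K (z.2.rev, Qm - z.1)) *
      ((((klScale klE0 (n + 1) - klScale klE0 n) * (-Wd t (z.2, z.1) * D (z.2.rev, Qm - z.1) - D (z.2, z.1) * Wd t (z.2.rev, Qm - z.1))) : ℝ) : ℂ))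
    {z : TorusSite 2 L × MatsubaraIdx M} (hz : BrD z ≠ 0) : matsubaraFreq β M z.2 ^ 2 ≤ (4 * klScale klE0 (n + 1)) ^ 2 := by
  have h10 := (klmf_klScale_succ_pos_le n).2
  have hmem := klws_affine_mem_Icc h10 ht
  have hsucc : klScale klE0 (n + 1) = klScale klE0 n / 4 := klth_klScale_succ n
  by_contra hlt
  push Not at hlt
  refine hz (klpd_rate_eq_zero_of_sq_lt β μ K n ht D Wd hWd Qm BrD hBr ?_)
  have h4 : 4 * klScale klE0 (n + 1) = klScale klE0 n := by rw [hsucc]; ring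
  rw [h4] at hlt
  have h0 : 0 ≤ klScale klE0 n + t * (klScale klE0 (n + 1) - klScale klE0 n) := (klmf_klScale_succ_pos_le n).1.le.trans hmem.1
  exact lt_of_le_of_lt (pow_le_pow_left₀ h0 hmem.2 2) hlt

/-- **Ball support**: frame with `|K(p_k⃗)| ≤ A`, `Λₙ + A ≤ e₀`, weight `0 ≤ D ≤ 1 − w^K_{Λ_m}` with `n ≤ m` ⇒ `z.1 ∉ klBall L μ 0 ⇒ BrD z = 0`. -/
theorem klpd_rate_eq_zero_of_not_mem_ball (n : ℕ) {t : ℝ} (ht : t ∈ Icc (0 : ℝ) 1) {A : ℝ}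
    (hKA : ∀ k : TorusSite 2 L, |K.eval (latticeMomentum L k)| ≤ A) (hA : klScale klE0 n + A ≤ klE0)
    {m : ℕ} (hm : n ≤ m) (D : FreqMomentum L M → ℝ) (hD : ∀ k, 0 ≤ D k ∧ D k ≤ 1 - hubbardCutoffWeightCT L M β μ K (klScale klE0 m) k)
    (Wd : ℝ → FreqMomentum L M → ℝ)
    (hWd : Wd = fun t k => deriv (fun Λ' : ℝ => hubbardCutoffWeightCT L M β μ K Λ' k) (klScale klE0 n + t * (klScale klE0 (n + 1) - klScale klE0 n)))
    (Qm : TorusSite 2 L) (BrD : TorusSite 2 L × MatsubaraIdx M → ℂ)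
    (hBr : BrD = fun z => -(((((β * (L : ℝ) ^ 2 : ℝ) : ℂ)))⁻¹ * propCT L M β μ K (z.2, z.1) * propCT L M β μ K (z.2.rev, Qm - z.1)) *
      ((((klScale klE0 (n + 1) - klScale klE0 n) * (-Wd t (z.2, z.1) * D (z.2.rev, Qm - z.1) - D (z.2, z.1) * Wd t (z.2.rev, Qm - z.1))) : ℝ) : ℂ))
    {z : TorusSite 2 L × MatsubaraIdx M} (hz : z.1 ∉ klBall L μ 0) : BrD z = 0 := by
  have h10 := (klmf_klScale_succ_pos_le n).2
  have h1 := (klmf_klScale_succ_pos_le n).1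
  have hΛn : 0 < klScale klE0 n := klth_klScale_pos n
  have hΛm : 0 < klScale klE0 m := klth_klScale_pos m
  set Λt : ℝ := klScale klE0 n + t * (klScale klE0 (n + 1) - klScale klE0 n) with hΛt_def
  have hmem : Λt ∈ Icc (klScale klE0 (n + 1)) (klScale klE0 n) := klws_affine_mem_Icc h10 ht
  have hΛt : 0 < Λt := h1.trans_le hmem.1
  have hξ : klE0 < |nambuXi L μ z.1| := by
    have h : ¬ |nambuXi L μ z.1| ≤ klScale klE0 0 := by
      rwa [klBall, klShell, mem_momentumShell, nambuXiCT_zero_frame] at hz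
    rw [klScale, pow_zero, inv_one, mul_one] at h
    exact lt_of_not_ge h
  have he : klScale klE0 n < |nambuXiCT L μ K z.1| := by
    have hsum : |nambuXi L μ z.1| ≤ |nambuXiCT L μ K z.1| + |K.eval (latticeMomentum L z.1)| := by
      rw [nambuXi_eq_nambuXiCT_add L μ K]; exact abs_add_le _ _
    linarith [hKA z.1]
  have hsq : klScale klE0 n ^ 2 < nambuXiCT L μ K z.1 ^ 2 := by
    rw [← sq_abs (nambuXiCT L μ K z.1)]
    exact pow_lt_pow_left₀ he hΛn.le two_ne_zero
  have hsqt : Λt ^ 2 < matsubaraFreq β M z.2 ^ 2 + nambuXiCT L μ K z.1 ^ 2 := by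
    have : Λt ^ 2 ≤ klScale klE0 n ^ 2 := pow_le_pow_left₀ hΛt.le hmem.2 2
    nlinarith [sq_nonneg (matsubaraFreq β M z.2)]
  have hW₁ : Wd t (z.2, z.1) = 0 := by
    rw [hWd]
    exact klws_deriv_cutoffWeight_scale_eq_zero L M β μ K hΛt.ne' (z.2, z.1) (Or.inr hsqt)
  have hmn : klScale klE0 m ≤ klScale klE0 n := by
    rw [klScale, klScale]
    refine mul_le_mul_of_nonneg_left ?_ (by norm_num [klE0])
    exact inv_anti₀ (by positivity) (pow_le_pow_right₀ (by norm_num) hm)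
  have hD₁ : D (z.2, z.1) = 0 := by
    have hw1 : hubbardCutoffWeightCT L M β μ K (klScale klE0 m) (z.2, z.1) = 1 :=
      hubbardCutoffWeightCT_eq_one_of_sq_le β μ K hΛm (z.2, z.1) (by
        simp only
        have : klScale klE0 m ^ 2 ≤ klScale klE0 n ^ 2 := pow_le_pow_left₀ hΛm.le hmn 2
        nlinarith [sq_nonneg (matsubaraFreq β M z.2)])
    have h := hD (z.2, z.1)
    rw [hw1, sub_self] at h
    exact le_antisymm h.2 h.1
  simp only [hBr, hW₁, hD₁, neg_zero, zero_mul, mul_zero, sub_zero, Complex.ofReal_zero]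

/-- … contrapositive: `BrD z ≠ 0 ⇒ z.1 ∈ klBall L μ 0`. -/
theorem klpd_mem_ball_of_rate_ne_zero (n : ℕ) {t : ℝ} (ht : t ∈ Icc (0 : ℝ) 1) {A : ℝ}
    (hKA : ∀ k : TorusSite 2 L, |K.eval (latticeMomentum L k)| ≤ A) (hA : klScale klE0 n + A ≤ klE0)
    {m : ℕ} (hm : n ≤ m) (D : FreqMomentum L M → ℝ) (hD : ∀ k, 0 ≤ D k ∧ D k ≤ 1 - hubbardCutoffWeightCT L M β μ K (klScale klE0 m) k)
    (Wd : ℝ → FreqMomentum L M → ℝ)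
    (hWd : Wd = fun t k => deriv (fun Λ' : ℝ => hubbardCutoffWeightCT L M β μ K Λ' k) (klScale klE0 n + t * (klScale klE0 (n + 1) - klScale klE0 n)))
    (Qm : TorusSite 2 L) (BrD : TorusSite 2 L × MatsubaraIdx M → ℂ)
    (hBr : BrD = fun z => -(((((β * (L : ℝ) ^ 2 : ℝ) : ℂ)))⁻¹ * propCT L M β μ K (z.2, z.1) * propCT L M β μ K (z.2.rev, Qm - z.1)) *
      ((((klScale klE0 (n + 1) - klScale klE0 n) * (-Wd t (z.2, z.1) * D (z.2.rev, Qm - z.1) - D (z.2, z.1) * Wd t (z.2.rev, Qm - z.1))) : ℝ) : ℂ))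
    {z : TorusSite 2 L × MatsubaraIdx M} (hz : BrD z ≠ 0) : z.1 ∈ klBall L μ 0 := by
  by_contra h
  exact hz (klpd_rate_eq_zero_of_not_mem_ball β μ K n ht hKA hA hm D hD Wd hWd Qm BrD hBr h)

end Pointwise

end Summit.HubbardSuperconductivity.HubbardSuperconductivity.Theorems.KLRegimeSplit

end
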